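import Literature.Barriers.AtomisticToContinuum.StrongPinningBreathers
import Literature.MathematicalPhysics.KineticTheory.LangevinChainNESSProofs
import Mathlib.Analysis.SpecialFunctions.Pow.Deriv
import HarnessLib

/-!
# The Hairer–Mattingly chain: regularity and coercivity of the energy, and compact superlevel sets of `L𝒱` from a Theorem 5.6-type drift bound

`Literature/Barriers/AtomisticToContinuum/` (D-0021 catalogue), companion to
`StrongPinningBreathers.lean` (barrier fact `HairerMattingly2009_threeOscillators`: for three
oscillators with homogeneous pinning `|q|^{2k}/(2k)`, `k > 3/2`, and harmonic coupling there is a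
Markov semigroup of the chain with exactly one invariant probability measure). THEOREMS ONLY (no
new definition, no new named fact): the elementary layer of the printed existence proof, for the
tree's chain `homogeneouslyPinnedChain k γ` and its `deriv`-based `OscillatorChain.generator`.

## Source

M. Hairer, J. C. Mattingly, *Slow energy dissipation in anharmonic oscillator chains*, Comm. Pure
Appl. Math. **62** (2009) 999–1032, arXiv:0712.3884 (locators of the arXiv version).

* §2, eq. (e:threeosc): the three-oscillator system with pinning force `-q|q|^{2k-2}`, harmonic
  coupling and Langevin baths on the two outer oscillators, "for some real number `k > 1`"; `H` is
  the total Hamiltonian (e:defH) `∑ (p_i²/2 + |q_i|^{2k}/2k) + ∑ (q_i - q_{i-1})²/2`.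
* Proposition 5.1 (a variant of Kryloff–Bogoliouboff): "Consider an SDE on `ℝⁿ` with smooth
  coefficients and denote its generator by `L`. Assume that the SDE has global solutions and
  generates a Feller semigroup. If there exists a smooth function `𝒱 : ℝⁿ → [0,∞)` such that the
  level sets `{x : L𝒱(x) ≥ C}` are compact for every `C`, then the SDE possesses an invariant
  probability measure `μ`."
* Theorem 5.6: "Consider the equations of motion (e:threeosc) with `k > 3/2`. Then there exists a
  function `𝒱` and constants `c, C > 0` such that `𝒱 ≥ cH^α - C` and such that `L𝒱 ≤ C - cH^{α'}`
  for some exponents `α` and `α'`"; proof: "`𝒱` grows at infinity (has compact level sets)".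
* §3.1: "The constant `k` is not necessarily an integer, so that in general the function `H_f` is
  not `C^∞` but only `C^{[2k]}`."

## Contents (all PROVED)

* `homogeneouslyPinnedChain_contDiff_U` (`U = (q²)^k/(2k)` is `C¹` for `k ≥ 1`),
  `homogeneouslyPinnedChain_contDiff_V`, `homogeneouslyPinnedChain_continuous_hamiltonian`,
  `homogeneouslyPinnedChain_hamiltonian_nonneg`, `homogeneouslyPinnedChain_site_le_hamiltonian`
  (`p_i²/2 + |q_i|^{2k}/2k ≤ H`), `homogeneouslyPinnedChain_norm_le_of_hamiltonian_le`
  (`H(x) ≤ E ⇒ ‖x‖ ≤ 1 + 2E + 2kE`) and `homogeneouslyPinnedChain_isCompact_setOf_hamiltonian_le`: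
  the Hairer–Mattingly Hamiltonian is nonnegative, continuous and COERCIVE (compact sublevel sets).
* `homogeneouslyPinnedChain_two`: for `k = 2` the chain IS the discrete `φ⁴` chain `phi4Chain 0 1 γ`
  of `FouriersLaw.lean` (the `ω₂ = 0`, `lam = 1`, `β = 0` corner of the `pinnedChain` family, outside
  the range `ω₂ > 0` of the tree's semigroup construction `pinnedChainSemigroup`).
* `OscillatorChain.setOf_le_generator_subset`, `OscillatorChain.isCompact_setOf_le_generator` — the
  step from Theorem 5.6 to the hypothesis of Proposition 5.1, for ANY chain with `C¹` potentials and
  nonnegative coercive energy: a pointwise drift bound `L𝒱 ≤ C - cH^{α'}` (`c, α' > 0`, `𝒱 ∈ C²`)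
  puts `{L𝒱 ≥ R}` inside `{H ≤ ((C - R)/c)^{1/α'}}`, so every superlevel set of `L𝒱` is compact;
  `homogeneouslyPinnedChain_isCompact_setOf_le_generator` is the specialisation to the
  Hairer–Mattingly chain (any number of sites, `k ≥ 1`).

## What is NOT here

Theorem 5.6 itself (the twenty-page averaging construction of `𝒱`, §4–§5), the transition semigroup
of (e:threeosc) as a `LangevinChainSemigroup` (the tree's construction `LangevinChainSDE/Kernel/
Dynkin.lean` is written for `pinnedChain` with `ω₂ > 0` only), the Itô/localisation passage of
Proposition 5.1, and the uniqueness half of the abstract ("follows quickly from the hypoellipticity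
of the generator and the Hamiltonian structure", §1) — the remaining decomposition of
`HairerMattingly2009_threeOscillators`, recorded in the provefact unit's notes (D-0026: no new named
fact is minted here).
-/

noncomputable section

open MeasureTheory Filter Topology
open scoped ContDiff

namespace Literature.Barriers.AtomisticToContinuum.HeatConduction

open Literature.MathematicalPhysics.KineticTheory.HeatConduction

/-! ### The Hairer–Mattingly Hamiltonian: regularity, positivity, coercivity -/

/-- `|q|^{2k} = (q²)^k` (real powers of the nonnegative base `|q|`). [folklore] -/
theorem abs_rpow_two_mul (q k : ℝ) : |q| ^ (2 * k) = (q ^ 2) ^ k := by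
  rw [Real.rpow_mul (abs_nonneg q), Real.rpow_two, sq_abs]

/-- The homogeneous pinning `U(q) = |q|^{2k}/(2k) = (q²)^k/(2k)` is `C¹` for `k ≥ 1` (indeed
`C^{[2k]}`, HM 2009 §3.1; `C¹` is what the continuity of `L f` needs). [cite: HairerMattingly2009, §3.1] -/
theorem homogeneouslyPinnedChain_contDiff_U {k : ℝ} (hk : 1 ≤ k) (γ : ℝ) :
    ContDiff ℝ 1 (homogeneouslyPinnedChain k γ).U := by
  have h : (homogeneouslyPinnedChain k γ).U = fun q => (q ^ 2) ^ k / (2 * k) := by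
    funext q
    simp only [homogeneouslyPinnedChain, abs_rpow_two_mul]
  rw [h]
  have h1 : ContDiff ℝ ((1 : ℕ) : WithTop ℕ∞) (fun x : ℝ => x ^ k) :=
    Real.contDiff_rpow_const_of_le (by exact_mod_cast hk)
  rw [Nat.cast_one] at h1
  exact (h1.comp (contDiff_id.pow 2)).div_const _

/-- The harmonic coupling `V(r) = r²/2` is smooth. [folklore] -/
theorem homogeneouslyPinnedChain_contDiff_V (k γ : ℝ) {n : WithTop ℕ∞} :
    ContDiff ℝ n (homogeneouslyPinnedChain k γ).V := by
  have h : (homogeneouslyPinnedChain k γ).V = fun r => r ^ 2 / 2 := by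
    funext r
    simp only [homogeneouslyPinnedChain]
  rw [h]
  exact (contDiff_id.pow 2).div_const _

/-- The pinning is continuous for every `k ≥ 0`. [folklore] -/
theorem homogeneouslyPinnedChain_continuous_U {k : ℝ} (hk : 0 ≤ k) (γ : ℝ) :
    Continuous (homogeneouslyPinnedChain k γ).U := by
  have h : (homogeneouslyPinnedChain k γ).U = fun q => |q| ^ (2 * k) / (2 * k) := by
    funext q
    simp only [homogeneouslyPinnedChain]
  rw [h]
  exact (continuous_abs.rpow_const fun _ => Or.inr (by linarith)).div_const _

/-- The Hairer–Mattingly Hamiltonian is continuous (`k ≥ 0`). [folklore] -/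
theorem homogeneouslyPinnedChain_continuous_hamiltonian {k : ℝ} (hk : 0 ≤ k) (γ : ℝ) (N : ℕ) :
    Continuous ((homogeneouslyPinnedChain k γ).hamiltonian N) :=
  (homogeneouslyPinnedChain k γ).continuous_hamiltonian (homogeneouslyPinnedChain_continuous_U hk γ)
    (homogeneouslyPinnedChain_contDiff_V k γ (n := 0)).continuous N

/-- The Hairer–Mattingly Hamiltonian is nonnegative (`k > 0`): every term `p_i²/2`,
`|q_i|^{2k}/(2k)`, `(q_{i+1} - q_i)²/2` is. [folklore] -/
theorem homogeneouslyPinnedChain_hamiltonian_nonneg {k : ℝ} (hk : 0 < k) (γ : ℝ) (N : ℕ)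
    (x : PhaseSpace N) : 0 ≤ (homogeneouslyPinnedChain k γ).hamiltonian N x := by
  unfold OscillatorChain.hamiltonian homogeneouslyPinnedChain
  refine add_nonneg (Finset.sum_nonneg fun i _ => ?_)
    (Finset.sum_nonneg fun i _ => Finset.sum_nonneg fun j _ => ?_)
  · dsimp only
    have : 0 ≤ |x.1 i| ^ (2 * k) / (2 * k) :=
      div_nonneg (Real.rpow_nonneg (abs_nonneg _) _) (by linarith)
    positivity
  · split_ifs
    · dsimp only
      positivity
    · exact le_rfl

/-- Each site energy is dominated by the total energy: `p_i²/2 + |q_i|^{2k}/(2k) ≤ H(x)`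
(`k > 0`). [folklore] -/
theorem homogeneouslyPinnedChain_site_le_hamiltonian {k : ℝ} (hk : 0 < k) (γ : ℝ) (N : ℕ)
    (x : PhaseSpace N) (i : Fin N) :
    x.2 i ^ 2 / 2 + |x.1 i| ^ (2 * k) / (2 * k) ≤ (homogeneouslyPinnedChain k γ).hamiltonian N x := by
  unfold OscillatorChain.hamiltonian
  have hS2 : 0 ≤ ∑ i : Fin N, ∑ j : Fin N,
      (if j.val = i.val + 1 then (homogeneouslyPinnedChain k γ).V (x.1 j - x.1 i) else 0) :=
    Finset.sum_nonneg fun i _ => Finset.sum_nonneg fun j _ => by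
      split_ifs
      · simp only [homogeneouslyPinnedChain]
        positivity
      · exact le_rfl
  have hterm : ∀ j : Fin N, 0 ≤ x.2 j ^ 2 / 2 + (homogeneouslyPinnedChain k γ).U (x.1 j) := fun j => by
    simp only [homogeneouslyPinnedChain]
    have : 0 ≤ |x.1 j| ^ (2 * k) / (2 * k) :=
      div_nonneg (Real.rpow_nonneg (abs_nonneg _) _) (by linarith)
    positivity
  have hle : x.2 i ^ 2 / 2 + (homogeneouslyPinnedChain k γ).U (x.1 i) ≤
      ∑ j, (x.2 j ^ 2 / 2 + (homogeneouslyPinnedChain k γ).U (x.1 j)) :=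
    Finset.single_le_sum (f := fun j => x.2 j ^ 2 / 2 + (homogeneouslyPinnedChain k γ).U (x.1 j))
      (fun j _ => hterm j) (Finset.mem_univ i)
  have hU : (homogeneouslyPinnedChain k γ).U (x.1 i) = |x.1 i| ^ (2 * k) / (2 * k) := by
    simp only [homogeneouslyPinnedChain]
  rw [hU] at hle
  linarith

/-- For `2k ≥ 1`, `|q| ≤ 1 + |q|^{2k}`. [folklore] -/
theorem abs_le_one_add_abs_rpow {k : ℝ} (hk : 1 ≤ 2 * k) (q : ℝ) : |q| ≤ 1 + |q| ^ (2 * k) := by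
  have h0 : 0 ≤ |q| ^ (2 * k) := Real.rpow_nonneg (abs_nonneg q) _
  rcases le_or_gt |q| 1 with h | h
  · linarith
  · have : |q| ^ (1 : ℝ) ≤ |q| ^ (2 * k) := Real.rpow_le_rpow_of_exponent_le h.le hk
    rw [Real.rpow_one] at this
    linarith

/-- **Energy controls the phase-space norm**: if `H(x) ≤ E` then `‖x‖ ≤ 1 + 2E + 2kE`
(`2k ≥ 1`; sup norm on `PhaseSpace N`). [folklore] -/
theorem homogeneouslyPinnedChain_norm_le_of_hamiltonian_le {k : ℝ} (hk : 1 ≤ 2 * k) (γ : ℝ) (N : ℕ)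
    {x : PhaseSpace N} {E : ℝ} (h : (homogeneouslyPinnedChain k γ).hamiltonian N x ≤ E) :
    ‖x‖ ≤ 1 + 2 * E + 2 * k * E := by
  have hk0 : 0 < k := by linarith
  have hE : 0 ≤ E := (homogeneouslyPinnedChain_hamiltonian_nonneg hk0 γ N x).trans h
  have hsite := fun i => (homogeneouslyPinnedChain_site_le_hamiltonian hk0 γ N x i).trans h
  have hq : ∀ i, |x.1 i| ≤ 1 + 2 * E + 2 * k * E := fun i => by
    have h1 := hsite i
    have hp0 : 0 ≤ x.2 i ^ 2 / 2 := by positivity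
    have h2 : |x.1 i| ^ (2 * k) / (2 * k) ≤ E := by linarith
    have h3 : |x.1 i| ^ (2 * k) ≤ 2 * k * E := by
      have := (div_le_iff₀ (by positivity : (0 : ℝ) < 2 * k)).1 h2
      linarith
    have h4 := abs_le_one_add_abs_rpow hk (x.1 i)
    nlinarith
  have hp : ∀ i, |x.2 i| ≤ 1 + 2 * E + 2 * k * E := fun i => by
    have h1 := hsite i
    have hq0 : 0 ≤ |x.1 i| ^ (2 * k) / (2 * k) :=
      div_nonneg (Real.rpow_nonneg (abs_nonneg _) _) (by linarith)
    have h2 : x.2 i ^ 2 ≤ 2 * E := by linarith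
    -- `|p| ≤ 1 + p²` (cf. `Literature.Probability.Process.abs_le_one_add_sq`, not imported here)
    have h4 : |x.2 i| ≤ 1 + x.2 i ^ 2 := by
      nlinarith [sq_nonneg (|x.2 i| - 1), sq_abs (x.2 i), abs_nonneg (x.2 i)]
    nlinarith
  have hR : 0 ≤ 1 + 2 * E + 2 * k * E := by positivity
  rw [Prod.norm_def, max_le_iff, pi_norm_le_iff_of_nonneg hR, pi_norm_le_iff_of_nonneg hR]
  exact ⟨fun i => by rw [Real.norm_eq_abs]; exact hq i, fun i => by rw [Real.norm_eq_abs]; exact hp i⟩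

/-- **Coercivity of the Hairer–Mattingly Hamiltonian**: the sublevel sets `{H ≤ E}` are compact
(`2k ≥ 1`): closed by continuity and bounded by `homogeneouslyPinnedChain_norm_le_of_hamiltonian_le`.
This is the property to which "`𝒱` grows at infinity (has compact level sets)" is reduced in the
proof of HM 2009 Thm 5.6. [folklore] -/
theorem homogeneouslyPinnedChain_isCompact_setOf_hamiltonian_le {k : ℝ} (hk : 1 ≤ 2 * k) (γ : ℝ)
    (N : ℕ) (E : ℝ) : IsCompact {x : PhaseSpace N | (homogeneouslyPinnedChain k γ).hamiltonian N x ≤ E} := by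
  have hk0 : 0 ≤ k := by linarith
  have hclosed : IsClosed {x : PhaseSpace N | (homogeneouslyPinnedChain k γ).hamiltonian N x ≤ E} :=
    isClosed_le (homogeneouslyPinnedChain_continuous_hamiltonian hk0 γ N) continuous_const
  refine (isCompact_closedBall (0 : PhaseSpace N) (1 + 2 * E + 2 * k * E)).of_isClosed_subset hclosed ?_
  intro x hx
  rw [Metric.mem_closedBall, dist_zero_right]
  exact homogeneouslyPinnedChain_norm_le_of_hamiltonian_le hk γ N hx

/-- For `k = 2` the Hairer–Mattingly chain IS the discrete `φ⁴` chain `phi4Chain 0 1 γ` of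
`FouriersLaw.lean` (pure quartic pinning `q⁴/4`, harmonic coupling, friction `γ`), i.e. the
`ω₂ = 0`, `lam = 1`, `β = 0` corner of the `pinnedChain` family — outside the range `ω₂ > 0` of the
tree's semigroup construction `pinnedChainSemigroup`. [folklore] -/
theorem homogeneouslyPinnedChain_two (γ : ℝ) : homogeneouslyPinnedChain 2 γ = phi4Chain 0 1 γ := by
  have hU : (homogeneouslyPinnedChain 2 γ).U = (phi4Chain 0 1 γ).U :=
    funext (homogeneouslyPinnedChain_two_U γ)
  have hV : (homogeneouslyPinnedChain 2 γ).V = (phi4Chain 0 1 γ).V :=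
    funext (homogeneouslyPinnedChain_V 2 γ)
  have hγ : (homogeneouslyPinnedChain 2 γ).γ = (phi4Chain 0 1 γ).γ := rfl
  cases h1 : homogeneouslyPinnedChain 2 γ with
  | mk U1 V1 g1 =>
    cases h2 : phi4Chain 0 1 γ with
    | mk U2 V2 g2 =>
      rw [h1, h2] at hU hV hγ
      simp only at hU hV hγ
      rw [hU, hV, hγ]

end Literature.Barriers.AtomisticToContinuum.HeatConduction

/-! ### From a Theorem 5.6-type drift bound to the hypothesis of Proposition 5.1 -/

namespace Literature.MathematicalPhysics.KineticTheory.HeatConduction.OscillatorChain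

variable (P : OscillatorChain) {N : ℕ}

/-- **The superlevel sets of `L𝒱` sit inside sublevel sets of `H`.** If `L𝒱 ≤ C - cH^{α'}`
pointwise with `c, α' > 0` and `H ≥ 0`, then `{L𝒱 ≥ R} ⊆ {H ≤ ((C - R)/c)^{1/α'}}` (declared as a
dot-notation extension of `OscillatorChain`, which lives in `FouriersLaw.lean`). [folklore] -/
theorem setOf_le_generator_subset {T_L T_R : ℝ} {𝒱 : PhaseSpace N → ℝ} {c C α' : ℝ} (hc : 0 < c)
    (hα : 0 < α') (hH : ∀ x, 0 ≤ P.hamiltonian N x)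
    (hL : ∀ x, P.generator N T_L T_R 𝒱 x ≤ C - c * P.hamiltonian N x ^ α') (R : ℝ) :
    {x | R ≤ P.generator N T_L T_R 𝒱 x} ⊆ {x | P.hamiltonian N x ≤ ((C - R) / c) ^ (1 / α')} := by
  intro x hx
  have h1 : c * P.hamiltonian N x ^ α' ≤ C - R := by
    have := hL x
    have hx' : R ≤ P.generator N T_L T_R 𝒱 x := hx
    linarith
  have h2 : P.hamiltonian N x ^ α' ≤ (C - R) / c := by
    rw [le_div_iff₀ hc]
    linarith
  have h3 : (P.hamiltonian N x ^ α') ^ (1 / α') ≤ ((C - R) / c) ^ (1 / α') :=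
    Real.rpow_le_rpow (Real.rpow_nonneg (hH x) _) h2 (by positivity)
  have h4 : (P.hamiltonian N x ^ α') ^ (1 / α') = P.hamiltonian N x := by
    rw [← Real.rpow_mul (hH x), mul_one_div_cancel hα.ne', Real.rpow_one]
  rw [h4] at h3
  exact h3

/-- **A Theorem 5.6-type drift bound gives the hypothesis of Proposition 5.1.** For a chain with
`C¹` potentials and nonnegative energy with compact sublevel sets, if `𝒱 ∈ C²` satisfies
`L𝒱 ≤ C - cH^{α'}` pointwise (`c, α' > 0`), then every superlevel set `{x : L𝒱(x) ≥ R}` is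
compact ("the level sets `{x : L𝒱(x) ≥ C}` are compact for every `C`", HM 2009 Prop. 5.1): it is
closed since `L𝒱` is continuous (`continuous_generator`) and contained in a sublevel set of `H`
(`setOf_le_generator_subset`). [cite: HairerMattingly2009, Prop 5.1 and Thm 5.6 (proof)] -/
theorem isCompact_setOf_le_generator (hU : ContDiff ℝ 1 P.U) (hV : ContDiff ℝ 1 P.V)
    (hH : ∀ x, 0 ≤ P.hamiltonian N x) (hHc : ∀ E : ℝ, IsCompact {x | P.hamiltonian N x ≤ E})
    (T_L T_R : ℝ) {𝒱 : PhaseSpace N → ℝ} (h𝒱 : ContDiff ℝ 2 𝒱) {c C α' : ℝ} (hc : 0 < c)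
    (hα : 0 < α') (hL : ∀ x, P.generator N T_L T_R 𝒱 x ≤ C - c * P.hamiltonian N x ^ α') (R : ℝ) :
    IsCompact {x | R ≤ P.generator N T_L T_R 𝒱 x} :=
  (hHc _).of_isClosed_subset (isClosed_le continuous_const (P.continuous_generator hU hV N T_L T_R h𝒱))
    (P.setOf_le_generator_subset hc hα hH hL R)

end Literature.MathematicalPhysics.KineticTheory.HeatConduction.OscillatorChain

namespace Literature.Barriers.AtomisticToContinuum.HeatConduction

open Literature.MathematicalPhysics.KineticTheory.HeatConduction

/-- **The Hairer–Mattingly chain: Theorem 5.6 ⇒ the hypothesis of Proposition 5.1.** For `k ≥ 1`,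
any number of sites and any bath temperatures: if `𝒱 ∈ C²` satisfies the drift bound
`L𝒱 ≤ C - cH^{α'}` of HM 2009 Thm 5.6 (`c, α' > 0`), then all superlevel sets `{L𝒱 ≥ R}` are
compact — by the coercivity of the Hairer–Mattingly energy. [cite: HairerMattingly2009, Thm 5.6 (proof) and Prop 5.1] -/
theorem homogeneouslyPinnedChain_isCompact_setOf_le_generator {k : ℝ} (hk : 1 ≤ k) (γ : ℝ) (N : ℕ)
    (T_L T_R : ℝ) {𝒱 : PhaseSpace N → ℝ} (h𝒱 : ContDiff ℝ 2 𝒱) {c C α' : ℝ} (hc : 0 < c)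
    (hα : 0 < α')
    (hL : ∀ x, (homogeneouslyPinnedChain k γ).generator N T_L T_R 𝒱 x ≤
      C - c * (homogeneouslyPinnedChain k γ).hamiltonian N x ^ α') (R : ℝ) :
    IsCompact {x | R ≤ (homogeneouslyPinnedChain k γ).generator N T_L T_R 𝒱 x} :=
  (homogeneouslyPinnedChain k γ).isCompact_setOf_le_generator (homogeneouslyPinnedChain_contDiff_U hk γ)
    ((homogeneouslyPinnedChain_contDiff_V k γ).of_le le_top)
    (homogeneouslyPinnedChain_hamiltonian_nonneg (by linarith) γ N)
    (homogeneouslyPinnedChain_isCompact_setOf_hamiltonian_le (by linarith) γ N) T_L T_R h𝒱 hc hα hL R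

end Literature.Barriers.AtomisticToContinuum.HeatConduction

end
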